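import Summits.QuantumFields.YangMills.Theorems.ColdStartUniversalityLatticeLangevinCarreDuChampDictionary
import HarnessLib

/-!
# Route `ColdStartUniversality` (fixed-cut-off package): the carré du champ of a PRODUCT — `√Γ(fg) ≤ |f|√Γ(g) + |g|√Γ(f)` — and of a
# finite product of bounded observables (`√Γ(∏ F_k) ≤ Σ_k √Γ(F_k)` when all `|F_k| ≤ 1`)

Helper file (seat `ym-line-csu-p1`, g28; `--supports stmt-QuantumFields-24809`).  In the coordinate currency of the fixed-cut-off package
(`Γ(f)(V) = Σ_(ij) ∂_if ∂_jf (σσᵀ)_(ij)(V) = Σ_n (Σ_i ∂_if σ_in)²`, `sum_sum_mul_mul_noiseCov_eq_sum_sq`), for functions of the real link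
coordinates of an `SU(2)` lattice gauge field on `(ℤ/L)³` (any `β'`: the noise coefficient does not depend on it):
* `sum_sq_mul_add_mul_le` — the finite-dimensional Minkowski/Cauchy–Schwarz step `Σ_n (φy_n + ψx_n)² ≤ (a + b)²` for `|φ|, |ψ| ≤ 1`,
  `Σx² ≤ a²`, `Σy² ≤ b²`;
* ★ `carre_mul_le` — if `|f(coords V)| ≤ 1`, `|g(coords V)| ≤ 1`, `Γ(f)(V) ≤ a²`, `Γ(g)(V) ≤ b²` then `Γ(fg)(V) ≤ (a + b)²` (Leibniz rule
  `∂(fg) = f∂g + g∂f`);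
* ★★ `carre_prod_le` — for a finite family `F : Fin m → …` of `C¹` functions with `|F_k(coords V)| ≤ 1` and `Γ(F_k)(V) ≤ a_k²`:
  `Γ(∏_k F_k)(V) ≤ (Σ_k a_k)²`.
Use: loop STRINGS — products of spatially averaged Wilson loops (each `|W̄| ≤ 1`, `Γ(W̄_(R×T)) ≤ 96(R+T)²/L³`) have `Γ ≤ 96(Σ_k(R_k+T_k))²/L³`, so
the transport–entropy mixing bounds (`…TransportMixing`, `…MacroscopicMixing`) extend to them with volume-independent constants
(`…LatticeLangevinLoopStringMixing`).  THEOREMS ONLY, no definition, no sorry; nothing here bears on the Yang–Mills mass gap. [folklore]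
-/

set_option autoImplicit false

noncomputable section

namespace Summit.QuantumFields.YangMills.Theorems.ColdStartUniversality

open scoped BigOperators
open Finset
open Literature.MathematicalPhysics.QuantumFieldTheory
open Literature.MathematicalPhysics.QuantumLattice (fundamentalRep fundamentalLatticeRep continuous_fundamentalRep)

/-! ## §1. The finite-dimensional step -/

/-- `Σ_n (φ y_n + ψ x_n)² ≤ (a + b)²` when `|φ| ≤ 1`, `|ψ| ≤ 1`, `Σ_n x_n² ≤ a²`, `Σ_n y_n² ≤ b²`, `a, b ≥ 0` (expand; Cauchy–Schwarz
`(Σ x y)² ≤ Σx² Σy²`). [folklore] -/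
theorem sum_sq_mul_add_mul_le {κ : Type*} [Fintype κ] (x y : κ → ℝ) {φ ψ a b : ℝ} (hφ : |φ| ≤ 1) (hψ : |ψ| ≤ 1)
    (ha : 0 ≤ a) (hb : 0 ≤ b) (hx : ∑ n, x n ^ 2 ≤ a ^ 2) (hy : ∑ n, y n ^ 2 ≤ b ^ 2) :
    ∑ n, (φ * y n + ψ * x n) ^ 2 ≤ (a + b) ^ 2 := by
  have hexp : ∑ n, (φ * y n + ψ * x n) ^ 2 = φ ^ 2 * ∑ n, y n ^ 2 + 2 * (φ * ψ) * ∑ n, x n * y n + ψ ^ 2 * ∑ n, x n ^ 2 := by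
    simp only [Finset.mul_sum, ← Finset.sum_add_distrib]
    exact Finset.sum_congr rfl fun n _ => by ring
  rw [hexp]
  have hX0 : 0 ≤ ∑ n, x n ^ 2 := Finset.sum_nonneg fun n _ => sq_nonneg _
  have hY0 : 0 ≤ ∑ n, y n ^ 2 := Finset.sum_nonneg fun n _ => sq_nonneg _
  have hφ2 : φ ^ 2 ≤ 1 := by
    have h := pow_le_one₀ (abs_nonneg φ) hφ (n := 2)
    rwa [sq_abs] at h
  have hψ2 : ψ ^ 2 ≤ 1 := by
    have h := pow_le_one₀ (abs_nonneg ψ) hψ (n := 2)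
    rwa [sq_abs] at h
  -- Cauchy–Schwarz
  have hCS : (∑ n, x n * y n) ^ 2 ≤ (a * b) ^ 2 := by
    calc (∑ n, x n * y n) ^ 2 ≤ (∑ n, x n ^ 2) * ∑ n, y n ^ 2 := Finset.sum_mul_sq_le_sq_mul_sq _ _ _
      _ ≤ a ^ 2 * b ^ 2 := mul_le_mul hx hy hY0 (sq_nonneg _)
      _ = (a * b) ^ 2 := by ring
  have hCS' : |∑ n, x n * y n| ≤ a * b := by
    have h := sq_le_sq.1 hCS
    rwa [abs_of_nonneg (mul_nonneg ha hb)] at h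
  have hφψ : |φ * ψ| ≤ 1 := by
    rw [abs_mul]
    calc |φ| * |ψ| ≤ 1 * 1 := mul_le_mul hφ hψ (abs_nonneg _) zero_le_one
      _ = 1 := one_mul 1
  have hmid : 2 * (φ * ψ) * ∑ n, x n * y n ≤ 2 * (a * b) := by
    have h1 : (φ * ψ) * ∑ n, x n * y n ≤ |φ * ψ| * |∑ n, x n * y n| := by
      rw [← abs_mul]; exact le_abs_self _
    have h2 : |φ * ψ| * |∑ n, x n * y n| ≤ 1 * (a * b) := mul_le_mul hφψ hCS' (abs_nonneg _) zero_le_one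
    linarith
  have h1 : φ ^ 2 * ∑ n, y n ^ 2 ≤ b ^ 2 := by
    calc φ ^ 2 * ∑ n, y n ^ 2 ≤ 1 * ∑ n, y n ^ 2 := mul_le_mul_of_nonneg_right hφ2 hY0
      _ ≤ b ^ 2 := by rw [one_mul]; exact hy
  have h2 : ψ ^ 2 * ∑ n, x n ^ 2 ≤ a ^ 2 := by
    calc ψ ^ 2 * ∑ n, x n ^ 2 ≤ 1 * ∑ n, x n ^ 2 := mul_le_mul_of_nonneg_right hψ2 hX0
      _ ≤ a ^ 2 := by rw [one_mul]; exact hx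
  nlinarith

/-! ## §2. The carré du champ of a product of two observables -/

/-- ★ **Carré du champ of a product.**  For differentiable `f, g` of the real link coordinates, a configuration `V` with `|f(coords V)| ≤ 1`,
`|g(coords V)| ≤ 1`, `Γ(f)(V) ≤ a²`, `Γ(g)(V) ≤ b²` (`a, b ≥ 0`): `Γ(fg)(V) ≤ (a + b)²` — i.e. `√Γ(fg) ≤ |f|√Γ(g) + |g|√Γ(f)` specialised to
bounded observables. [folklore] -/
theorem carre_mul_le (L : ℕ) [NeZero L] (β' : ℝ) (f g : (Edge 3 L × Fin 2 × Fin 2 × Bool → ℝ) → ℝ)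
    (hf : Differentiable ℝ f) (hg : Differentiable ℝ g) {a b : ℝ} (ha : 0 ≤ a) (hb : 0 ≤ b) :
    let coords : GaugeConfig 3 L (Matrix.specialUnitaryGroup (Fin 2) ℂ) → (Edge 3 L × Fin 2 × Fin 2 × Bool → ℝ) :=
      fun V q => (fun z : ℂ => if q.2.2.2 then z.im else z.re)
        ((fundamentalRep (Fin 2) (V q.1) : Matrix (Fin 2) (Fin 2) ℂ) q.2.1 q.2.2.1)
    let A : GaugeConfig 3 L (Matrix.specialUnitaryGroup (Fin 2) ℂ) → (Edge 3 L × Fin 2 × Fin 2 × Bool) →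
        (Edge 3 L × Fin 2 × Fin 2 × Bool) → ℝ := fun V i j =>
      ∑ n : Edge 3 L × NoiseIdx 2,
        (if n.1 = i.1 then (fun z : ℂ => if i.2.2.2 then z.im else z.re)
          ((latticeLangevinDynamics (fundamentalLatticeRep 2) β').noise
            (matrixConfig (fundamentalRep (Fin 2)) V) i.1 n.2 i.2.1 i.2.2.1) else 0) *
        (if n.1 = j.1 then (fun z : ℂ => if j.2.2.2 then z.im else z.re)
          ((latticeLangevinDynamics (fundamentalLatticeRep 2) β').noise
            (matrixConfig (fundamentalRep (Fin 2)) V) j.1 n.2 j.2.1 j.2.2.1) else 0)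
    ∀ V : GaugeConfig 3 L (Matrix.specialUnitaryGroup (Fin 2) ℂ), |f (coords V)| ≤ 1 → |g (coords V)| ≤ 1 →
      (∑ i : Edge 3 L × Fin 2 × Fin 2 × Bool, ∑ j : Edge 3 L × Fin 2 × Fin 2 × Bool, fderiv ℝ f (coords V) (Pi.single i 1) * fderiv ℝ f (coords V) (Pi.single j 1) * A V i j) ≤ a ^ 2 →
      (∑ i : Edge 3 L × Fin 2 × Fin 2 × Bool, ∑ j : Edge 3 L × Fin 2 × Fin 2 × Bool, fderiv ℝ g (coords V) (Pi.single i 1) * fderiv ℝ g (coords V) (Pi.single j 1) * A V i j) ≤ b ^ 2 →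
      (∑ i : Edge 3 L × Fin 2 × Fin 2 × Bool, ∑ j : Edge 3 L × Fin 2 × Fin 2 × Bool, fderiv ℝ (fun y => f y * g y) (coords V) (Pi.single i 1) * fderiv ℝ (fun y => f y * g y) (coords V) (Pi.single j 1) * A V i j) ≤ (a + b) ^ 2 := by
  intro coords A V hfb hgb hΓf hΓg
  classical
  set c : Edge 3 L × Fin 2 × Fin 2 × Bool → ℝ := coords V with hc
  set σ : (Edge 3 L × Fin 2 × Fin 2 × Bool) → (Edge 3 L × NoiseIdx 2) → ℝ := fun i n =>
    if n.1 = i.1 then (fun z : ℂ => if i.2.2.2 then z.im else z.re)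
      ((latticeLangevinDynamics (fundamentalLatticeRep 2) β').noise
        (matrixConfig (fundamentalRep (Fin 2)) V) i.1 n.2 i.2.1 i.2.2.1) else 0 with hσ
  have hA : ∀ i j, A V i j = ∑ n, σ i n * σ j n := fun i j => rfl
  simp_rw [hA] at hΓf hΓg ⊢
  rw [sum_sum_mul_mul_noiseCov_eq_sum_sq] at hΓf hΓg ⊢
  -- Leibniz rule for the partial derivatives of `fg`
  have hprod : ∀ i, fderiv ℝ (fun y => f y * g y) c (Pi.single i 1) = f c * fderiv ℝ g c (Pi.single i 1) + g c * fderiv ℝ f c (Pi.single i 1) := by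
    intro i
    rw [fderiv_fun_mul (hf c) (hg c)]
    simp only [add_apply, FunLike.coe_smul, Pi.smul_apply, smul_eq_mul]
  have hlin : ∀ n, ∑ i, fderiv ℝ (fun y => f y * g y) c (Pi.single i 1) * σ i n =
      f c * (∑ i, fderiv ℝ g c (Pi.single i 1) * σ i n) + g c * (∑ i, fderiv ℝ f c (Pi.single i 1) * σ i n) := by
    intro n
    simp_rw [hprod]
    rw [Finset.mul_sum, Finset.mul_sum, ← Finset.sum_add_distrib]
    exact Finset.sum_congr rfl fun i _ => by ring
  simp_rw [hlin]
  exact sum_sq_mul_add_mul_le (fun n => ∑ i, fderiv ℝ f c (Pi.single i 1) * σ i n) (fun n => ∑ i, fderiv ℝ g c (Pi.single i 1) * σ i n) hfb hgb ha hb hΓf hΓg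

/-! ## §3. Finite products of bounded observables -/

/-- ★★ **Carré du champ of a finite product of bounded observables.**  For `C¹` functions `F_k` (`k : Fin m`) of the real link coordinates
and a configuration `V` with `|F_k(coords V)| ≤ 1` and `Γ(F_k)(V) ≤ a_k²` (`a_k ≥ 0`) for all `k`: `Γ(∏_k F_k)(V) ≤ (Σ_k a_k)²`. [folklore] -/
theorem carre_prod_le (L : ℕ) [NeZero L] (β' : ℝ) (m : ℕ) (F : Fin m → (Edge 3 L × Fin 2 × Fin 2 × Bool → ℝ) → ℝ)
    (hF : ∀ k, ContDiff ℝ 1 (F k)) (a : Fin m → ℝ) (ha : ∀ k, 0 ≤ a k) :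
    let coords : GaugeConfig 3 L (Matrix.specialUnitaryGroup (Fin 2) ℂ) → (Edge 3 L × Fin 2 × Fin 2 × Bool → ℝ) :=
      fun V q => (fun z : ℂ => if q.2.2.2 then z.im else z.re)
        ((fundamentalRep (Fin 2) (V q.1) : Matrix (Fin 2) (Fin 2) ℂ) q.2.1 q.2.2.1)
    let A : GaugeConfig 3 L (Matrix.specialUnitaryGroup (Fin 2) ℂ) → (Edge 3 L × Fin 2 × Fin 2 × Bool) →
        (Edge 3 L × Fin 2 × Fin 2 × Bool) → ℝ := fun V i j =>
      ∑ n : Edge 3 L × NoiseIdx 2,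
        (if n.1 = i.1 then (fun z : ℂ => if i.2.2.2 then z.im else z.re)
          ((latticeLangevinDynamics (fundamentalLatticeRep 2) β').noise
            (matrixConfig (fundamentalRep (Fin 2)) V) i.1 n.2 i.2.1 i.2.2.1) else 0) *
        (if n.1 = j.1 then (fun z : ℂ => if j.2.2.2 then z.im else z.re)
          ((latticeLangevinDynamics (fundamentalLatticeRep 2) β').noise
            (matrixConfig (fundamentalRep (Fin 2)) V) j.1 n.2 j.2.1 j.2.2.1) else 0)
    ∀ V : GaugeConfig 3 L (Matrix.specialUnitaryGroup (Fin 2) ℂ), (∀ k, |F k (coords V)| ≤ 1) →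
      (∀ k, (∑ i : Edge 3 L × Fin 2 × Fin 2 × Bool, ∑ j : Edge 3 L × Fin 2 × Fin 2 × Bool, fderiv ℝ (F k) (coords V) (Pi.single i 1) * fderiv ℝ (F k) (coords V) (Pi.single j 1) * A V i j) ≤ a k ^ 2) →
      (∑ i : Edge 3 L × Fin 2 × Fin 2 × Bool, ∑ j : Edge 3 L × Fin 2 × Fin 2 × Bool, fderiv ℝ (fun y => ∏ k, F k y) (coords V) (Pi.single i 1) * fderiv ℝ (fun y => ∏ k, F k y) (coords V) (Pi.single j 1) * A V i j) ≤ (∑ k, a k) ^ 2 := by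
  intro coords A V
  induction m with
  | zero =>
      intro _ _
      have h0 : (fun y : (Edge 3 L × Fin 2 × Fin 2 × Bool → ℝ) => ∏ k : Fin 0, F k y) = fun _ => 1 := by
        funext y; simp
      rw [h0]
      simp
  | succ m ih =>
      intro hb hΓ
      have hfun : (fun y : (Edge 3 L × Fin 2 × Fin 2 × Bool → ℝ) => ∏ k : Fin (m + 1), F k y) =
          fun y => F 0 y * (fun y' => ∏ k : Fin m, F k.succ y') y := by
        funext y; exact Fin.prod_univ_succ _
      rw [hfun, Fin.sum_univ_succ]
      have hg : ContDiff ℝ 1 (fun y' : (Edge 3 L × Fin 2 × Fin 2 × Bool → ℝ) => ∏ k : Fin m, F k.succ y') :=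
        contDiff_prod (fun k _ => hF k.succ)
      have hgb : |(fun y' : (Edge 3 L × Fin 2 × Fin 2 × Bool → ℝ) => ∏ k : Fin m, F k.succ y') (coords V)| ≤ 1 := by
        beta_reduce
        rw [Finset.abs_prod]
        exact Finset.prod_le_one (fun k _ => abs_nonneg _) (fun k _ => hb k.succ)
      have hΓg := ih (fun k => F k.succ) (fun k => hF k.succ) (fun k => a k.succ) (fun k => ha k.succ) (fun k => hb k.succ) (fun k => hΓ k.succ)
      exact carre_mul_le L β' (F 0) _ ((hF 0).differentiable one_ne_zero) (hg.differentiable one_ne_zero) (ha 0)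
        (Finset.sum_nonneg fun k _ => ha k.succ) V (hb 0) hgb (hΓ 0) hΓg

end Summit.QuantumFields.YangMills.Theorems.ColdStartUniversality
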